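import Literature.Analysis.OperatorTheory.Enflo2023.MinimalNorm
import HarnessLib

/-!
# Enflo 2023, v2 eq. (13)–(17): the resolvent form `[ ]x₀ = (I + V_yV_y^*)⁻¹x₀` of the minimal move, without inverses

Source under adjudication: Per H. Enflo, *On the invariant subspace problem in Hilbert spaces*, arXiv:2305.15442 (v1
2023, v2 2024), bib key `Enflo2023` — a CLAIMED proof of the invariant subspace problem for operators on a separable
Hilbert space.  This file is part of the kernel-tight typing of the manuscript by the b2b-enflo repair cell
(formaliser 1, Part A: v2 eq. (1)–(27), the set-up, the constructions `V_y`, `ℓ'`, `[ ]x₀`, Lemma 1 and Case I/II of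
the main step).  It records what FOLLOWS (proved implications from the manuscript's displayed hypotheses) and, where a
step does not follow, the typed inference together with its refutation.  NOTHING here asserts that the manuscript's
main theorem holds; no declaration concludes the invariant subspace problem for an arbitrary operator.  Value
(BLOCK-2b): theorems / refutations of typed inferences about a text — not progress on the problem.

THE RESOLVENT FORM (13)–(17) of the minimal move (v2 pp.4–5).  The paper writes
`ℓ' = C (I + C V*V)^{-1} V* x₀`, pushes `V` through, rescales `y = C^{1/2} y'`, `ℓ = C^{-1/2} ℓ'` and puts
`[ ] := (I + V_y V_y^*)^{-1}`, so that (14) `V_{y'}ℓ' = V_y ℓ = V_yV_y^*[ ]x₀`, (15) `x₀ − ℓ(T)y = [ ]x₀`,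
(16) `‖ℓ‖₂² = ⟨V_yV_y^*[ ]x₀, [ ]x₀⟩ = εθ`, (17) `a_j = ⟨[ ]x₀, T^j y⟩`.
Here NO inverse is formed: `[ ]x₀` is introduced by its defining equation `z + W W† z = x₀` (`IsBracket W x₀ z`), which
has at most one solution (`IsBracket.unique`, since `⟪u + WW†u, u⟫ = ‖u‖² + ‖W†u‖²`), and the KKT identity (5)
(`IsMinimal.kkt` in `MinimalNorm.lean`) PRODUCES the solution: with `C = 1/C'`, `W := C^{1/2} V`, `z := x₀ − V ℓ'` one has
`z + WW†z = x₀` and `W†z = C^{-1/2} ℓ'` (`isBracket_of_kkt`).  Conversely every bracket point is the minimal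
move at its own radius (`IsBracket.isMinimal`), which is the content of the sentence after (14).
Results:
* `IsBracket`, `IsBracket.unique`, `IsBracket.sub_eq` (15), `IsBracket.inner_self_x₀`,
  `IsBracket.norm_sq_ell` (16: `‖W†z‖² = Re⟨Wℓ, x₀ − Wℓ⟩`, and the inner product is real), `IsBracket.isMinimal` (14),
  `isBracket_of_kkt` (5 ⇒ 14/15).  (17) is `ℓ = W† z` read coordinatewise once `W = V_y` (`Vy.lean`).
Origin: planner-b2b-enflo-1-0, 2026-08-18.  Imports `Literature.Analysis.OperatorTheory.Enflo2023.MinimalNorm`.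
-/

noncomputable section

open scoped InnerProductSpace ComplexConjugate
open ContinuousLinearMap
open Literature.Analysis.UnboundedOperators (inner_self_eq_coe_norm_sq)

namespace Literature.Analysis.OperatorTheory.Enflo2023

variable {E H : Type*}
  [NormedAddCommGroup E] [InnerProductSpace ℂ E] [CompleteSpace E]
  [NormedAddCommGroup H] [InnerProductSpace ℂ H] [CompleteSpace H]

/-- `z = [ ]x₀`, i.e. `z` solves `(I + W W†) z = x₀` (paper (15), with `W = V_y`). [cite: Enflo2023, v2 p.5, eq. (15)] -/
def IsBracket (W : E →L[ℂ] H) (x₀ z : H) : Prop := z + W (adjoint W z) = x₀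

section bracket
variable {W : E →L[ℂ] H} {x₀ z : H}

/-- `Re ⟪u + W W† u, u⟫ = ‖u‖² + ‖W†u‖²` — the operator `I + WW†` is bounded below by `I`. [folklore] -/
lemma re_inner_one_add (W : E →L[ℂ] H) (u : H) :
    (⟪u + W (adjoint W u), u⟫_ℂ).re = ‖u‖ ^ 2 + ‖adjoint W u‖ ^ 2 := by
  rw [inner_add_left, Complex.add_re, inner_self_eq_coe_norm_sq, Complex.ofReal_re, ← adjoint_inner_right, inner_self_eq_coe_norm_sq, Complex.ofReal_re]

/-- `I + W W†` is injective, so `[ ]x₀` is well defined (at most one bracket point). [cite: Enflo2023, v2 pp.4–5, eq. (13)–(16)] -/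
theorem IsBracket.unique {z' : H} (h : IsBracket W x₀ z) (h' : IsBracket W x₀ z') : z = z' := by
  have hd : (z - z') + W (adjoint W (z - z')) = 0 := by
    rw [map_sub, map_sub]
    have := congrArg₂ (· - ·) h h'
    simp only [sub_self] at this
    rw [← this]; abel
  have hre := re_inner_one_add W (z - z')
  rw [hd, inner_zero_left, Complex.zero_re] at hre
  have h0 : ‖z - z'‖ ^ 2 = 0 := by nlinarith [sq_nonneg ‖z - z'‖, sq_nonneg ‖adjoint W (z - z')‖]
  exact sub_eq_zero.1 (norm_eq_zero.1 (pow_eq_zero_iff two_ne_zero |>.1 h0))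

/-- (15): `x₀ − W ℓ = [ ]x₀` for `ℓ := W† [ ]x₀`. [cite: Enflo2023, v2 p.5, eq. (15)] -/
theorem IsBracket.sub_eq (h : IsBracket W x₀ z) : x₀ - W (adjoint W z) = z := by
  rw [sub_eq_iff_eq_add]; exact h.symm

/-- `⟪[ ]x₀, x₀⟫ = ‖[ ]x₀‖² + ‖ℓ‖²`. [cite: Enflo2023, v2 pp.4–5, eq. (13)–(16)] -/
theorem IsBracket.inner_self_x₀ (h : IsBracket W x₀ z) :
    ⟪z, x₀⟫_ℂ = (((‖z‖ ^ 2 + ‖adjoint W z‖ ^ 2 : ℝ)) : ℂ) := by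
  conv_lhs => rw [← h]
  rw [inner_add_right, inner_self_eq_coe_norm_sq, ← adjoint_inner_left, inner_self_eq_coe_norm_sq]
  push_cast; ring

/-- (16): `‖ℓ‖₂² = ⟨W ℓ, x₀ − W ℓ⟩` (paper's `⟨V_yV_y^*[ ]x₀, [ ]x₀⟩ = εθ`), as a complex identity … [cite: Enflo2023, v2 p.5, eq. (16)] -/
theorem IsBracket.inner_eq_norm_sq (h : IsBracket W x₀ z) :
    ⟪x₀ - W (adjoint W z), W (adjoint W z)⟫_ℂ = ((‖adjoint W z‖ ^ 2 : ℝ) : ℂ) := by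
  rw [h.sub_eq, ← adjoint_inner_left, inner_self_eq_coe_norm_sq]

/-- … and as the real statement `‖ℓ‖² = εθ`. [cite: Enflo2023, v2 p.5, eq. (16)] -/
theorem IsBracket.norm_sq_ell (h : IsBracket W x₀ z) :
    ‖adjoint W z‖ ^ 2 = (⟪x₀ - W (adjoint W z), W (adjoint W z)⟫_ℂ).re := by
  rw [h.inner_eq_norm_sq, Complex.ofReal_re]

/-- (14), the sentence after it: the bracket point is the minimal move of `W` at radius `‖[ ]x₀‖`:
`ℓ = W†[ ]x₀` is feasible with equality and has least norm among all feasible coefficient vectors. [cite: Enflo2023, v2 p.5, after eq. (14)] -/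
theorem IsBracket.isMinimal (h : IsBracket W x₀ z) : IsMinimal W x₀ ‖z‖ (adjoint W z) := by
  refine ⟨by rw [mem_feasible, h.sub_eq], fun b hb => ?_⟩
  rw [mem_feasible] at hb
  set ℓ := adjoint W z with hℓ
  -- Re ⟪ℓ, b⟫ = ‖z‖² + ‖ℓ‖² − Re ⟪z, x₀ − W b⟫ ≥ ‖ℓ‖²
  have h1 : ⟪ℓ, b⟫_ℂ = ⟪z, x₀⟫_ℂ - ⟪z, x₀ - W b⟫_ℂ := by
    rw [hℓ, adjoint_inner_left, inner_sub_right]; ring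
  have h2 : ‖ℓ‖ ^ 2 ≤ (⟪ℓ, b⟫_ℂ).re := by
    rw [h1, Complex.sub_re, h.inner_self_x₀, Complex.ofReal_re]
    have h3 : (⟪z, x₀ - W b⟫_ℂ).re ≤ ‖z‖ * ‖x₀ - W b‖ :=
      (Complex.re_le_norm _).trans (norm_inner_le_norm _ _)
    have h4 : ‖z‖ * ‖x₀ - W b‖ ≤ ‖z‖ * ‖z‖ := by gcongr
    nlinarith
  have h5 : (⟪ℓ, b⟫_ℂ).re ≤ ‖ℓ‖ * ‖b‖ := (Complex.re_le_norm _).trans (norm_inner_le_norm _ _)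
  by_cases hℓ0 : ℓ = 0
  · rw [hℓ0, norm_zero]; exact norm_nonneg _
  · have : 0 < ‖ℓ‖ := norm_pos_iff.2 hℓ0
    nlinarith

end bracket

/-- (5) ⇒ (14)/(15): from the KKT identity `V†(x₀ − V ℓ') = C' ℓ'` with `C' > 0` (so `C = 1/C'`), the rescaled
operator `W := C^{1/2} V` (in the paper: `V_y` with `y = C^{1/2} y'`) has bracket point `[ ]x₀ = x₀ − V ℓ'`, with
`W†[ ]x₀ = C^{-1/2} ℓ' =: ℓ` and `W ℓ = V ℓ'`. [cite: Enflo2023, v2 pp.3–5, eq. (5), (13)–(15)] -/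
theorem isBracket_of_kkt {V : E →L[ℂ] H} {x₀ : H} {a : E}
    {C' : ℝ} (hC' : 0 < C') (hk : adjoint V (x₀ - V a) = (C' : ℂ) • a) :
    let c : ℝ := Real.sqrt (1 / C')
    IsBracket ((c : ℂ) • V) x₀ (x₀ - V a) ∧
      adjoint ((c : ℂ) • V) (x₀ - V a) = ((1 / c : ℝ) : ℂ) • a ∧
      ((c : ℂ) • V) (((1 / c : ℝ) : ℂ) • a) = V a := by
  intro c
  have hc0 : 0 < c := Real.sqrt_pos.2 (by positivity)
  have hcc : c * c * C' = 1 := by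
    rw [← pow_two, Real.sq_sqrt (by positivity)]; field_simp
  have hadj : adjoint ((c : ℂ) • V) (x₀ - V a) = ((1 / c : ℝ) : ℂ) • a := by
    rw [map_smulₛₗ adjoint, smul_apply, hk, smul_smul, Complex.conj_ofReal]
    congr 1
    have hr : c * C' = 1 / c := by
      have hc0' : c ≠ 0 := hc0.ne'
      field_simp
      linear_combination hcc
    rw [← hr]; push_cast; ring
  have happ : ((c : ℂ) • V) (((1 / c : ℝ) : ℂ) • a) = V a := by
    rw [smul_apply, map_smul, smul_smul]
    have : (c : ℂ) * ((1 / c : ℝ) : ℂ) = 1 := by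
      have hc0' : (c : ℂ) ≠ 0 := by exact_mod_cast hc0.ne'
      push_cast; field_simp
    rw [this, one_smul]
  refine ⟨?_, hadj, happ⟩
  show (x₀ - V a) + ((c : ℂ) • V) (adjoint ((c : ℂ) • V) (x₀ - V a)) = x₀
  rw [hadj, happ]; abel

omit [CompleteSpace E] in
/-- In that situation `‖ℓ‖² = ‖C^{-1/2} ℓ'‖² = C'‖ℓ'‖²` (`= εθ` by `IsMinimal.eq6`). [folklore] -/
theorem norm_sq_rescaled (a : E) {C' : ℝ} (hC' : 0 < C') :
    ‖((1 / Real.sqrt (1 / C') : ℝ) : ℂ) • a‖ ^ 2 = C' * ‖a‖ ^ 2 := by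
  rw [norm_smul, Complex.norm_real, Real.norm_of_nonneg (by positivity), mul_pow, one_div,
    inv_pow, Real.sq_sqrt (by positivity)]
  field_simp

end Literature.Analysis.OperatorTheory.Enflo2023

end
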